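import Summits.HodgeConjecture.HodgeConjecture.Theorems.H413ChiNFinPin
import HarnessLib

/-!
# H413 ∕ E-2 `hF` glue (i) — THE CARRIER BRIDGE: the finite Weil representation `ω_f^{s}` of ANY compatible splitting `s` IS the
# place-assembled `Ω` of a reference family, UP TO A CONTINUOUS UNIT-MODULUS CHARACTER of `U(J₁)(𝔸_{F,f})`

Crux H413 (stmt-HodgeConjecture-24833), child line `F0_E2SiegelWeilWeilRange` stub `stub_SW2_siegelWeil` (ii) — the `hF` binder of ★
`E2SW2OrbitalSums.orbitalSums_bounded_of_finIntegrable` (p802916) is stated for the finite Weil representation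
`b ↦ R_e ω_f^{s}(1,b) R_e⁻¹` (★ `WeilCoinv.finPairRep … hs (1,b)`, `R_e = finSBReindex F e`) of the consumer's compatible splitting `s`, while
every FIN row of the tree (★ `integrable_finAdelic_of_pureTensor`, ★ `finCoeff_isPureTensor_of_Omega_line`, ★ `FinLocalSplittings.integrable_localCoeff`,
★ `exists_finCoeff_ne_zero_of_localSplittings`) is about the place-assembled `𝓢.Omega (finPairEmb … (1,b)) = ⊗'_v ω_v` of a restricted family
`𝓢` of local splittings.  THIS FILE names the bridge, which so far existed only INLINE in the proof of ★ `exists_finCoeff_ne_zero_of_compatible`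
(p800192): by [GelbartRogawski1991, §3.1 Remark p. 457] two compatible splittings differ by an automorphic character `ĉ` (★
`exists_eq_twist_of_isCompatible`), the finite Weil representation only sees the scalar `ĉ(1 ⊗ (1,b))` (★ `finPairRep_twist`), and on the
hermitian LINE `J₁` (`[U(J₁)]` compact) that scalar is unimodular (★ `norm_eq_one_of_forall_range_eq_one`).

* **`exists_finPairRep_eq_smul_Omega`** — GENERIC: given a reference compatible continuous splitting `sref` with
  `ω_f^{sref}(1,b) = R_e⁻¹ ∘ 𝓢.Omega(1 ⊗ b) ∘ R_e` (`href`; at the CM `χ`-line this is ★ `finPairRep_chiSplittingLine_apply`), there is a continuous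
  `w : U(J₁)(𝔸_{F,f}) → ℂ` with `‖w b‖ = 1` and `R_e (ω_f^{s}(1,b) (R_e⁻¹ Φ_f)) = w b • 𝓢.Omega (finPairEmb (1,b)) Φ_f` for all `b`, `Φ_f`;
* **`integrable_finCoeff_of_integrable_Omega`** ∕ **`integrable_Omega_of_integrable_finCoeff`** — hence the finite matrix coefficients
  `b ↦ ⟨R_e ω_f^{s}(1,b) R_e⁻¹ Φ_f, Ψ_f⟩_μ` and `b ↦ ⟨𝓢.Omega (finPairEmb (1,b)) Φ_f, Ψ_f⟩_μ` are integrable on `U(J₁)(𝔸_{F,f})` TOGETHER (the `hF`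
  binder's shape VERBATIM on the `finPairRep` side);
* **`exists_finPairRep_eq_smul_Omega_cm`**, **`integrable_finCoeff_cm_of_integrable_Omega`** — the CM line datum `(L⁺, L, c̄, diag dV, diag dW)`
  with the reference `χ`-line family `𝓢_χ = congrW (undoubledSplittings (cmFinLocalFamily χ))` for ANY unitary splitting character `χ`
  (all side conditions discharged as in ★ `exists_finCoeff_ne_zero_cm`, p803173).

KERNEL: theorems only, DEF-FREE, no `sorry`.  HC_CM is proved only modulo the printed citations until rung 0 closes.

[cite: GelbartRogawski1991, §3.1 Prop. 3.1.1 p. 455 and Remark p. 457 L4–13] [cite: Li1992, Thm 2.1 (27) p. 184; §5 p. 206]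
[cite: Liu2021, App. D §D.1 Steps 1–3 (l. 5214–5233)]
-/

set_option autoImplicit false
set_option linter.dupNamespace false

noncomputable section

open scoped RestrictedProduct ENNReal NNReal ComplexConjugate Matrix Kronecker
open MeasureTheory NumberField IsDedekindDomain Filter Function Set Topology
open Literature.NumberTheory.Automorphic Literature.NumberTheory.Automorphic.UnitaryGroup
open Literature.NumberTheory.Weil1964
open Literature.NumberTheory.GelbartRogawski1991 Literature.NumberTheory.GelbartRogawski1991.UnitaryDualPair
open Literature.NumberTheory.GelbartRogawski1991.UnitaryDualPair.WeilCoinv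
open Literature.NumberTheory.GelbartRogawski1991.UnitaryDualPair.LocalSplitting
open Literature.NumberTheory.GelbartRogawski1991.GRConstruction
open Literature.NumberTheory.Automorphic.Liu2021.Def411WeilCarriersDoubling
open Literature.RepresentationTheory.HarrisKudlaSweet1996
open Literature.NumberTheory.GaloisRepresentations

namespace Summit.HodgeConjecture.HodgeConjecture.Cruxes.H413.ThetaNonvanishing

/-! ## §1 Generic: `R_e ω_f^{s}(1,b) R_e⁻¹ = w(b) • Ω(1 ⊗ b)` with `w` continuous unimodular -/

section Generic

variable (F E : Type) [Field F] [NumberField F] [Field E] [NumberField E] [Algebra F E]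
  [Algebra.IsQuadraticExtension F E] (c : E ≃ₐ[F] E) (N : ℕ) {n : ℕ} (e : Fin N × Fin 1 ≃ Fin n)
  (JV : Matrix (Fin N) (Fin N) E) (J₁ : Matrix (Fin 1) (Fin 1) E)
  {δ : E} (hcδ : c δ = -δ) (hδ : δ ≠ 0) {d : F} (hd : δ * δ = algebraMap F E d)
  (Tb : Matrix (Fin n) (Fin n) F) (hTb : Tb.IsSymm) (hJb : Matrix.reindex e e (JV ⊗ₖ J₁) = Tb.map (algebraMap F E))
  (𝓢 : FinLocalSplittings F E c n hcδ hδ hd Tb hTb hJb)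
  {TV : Matrix (Fin N) (Fin N) F} {TW : Matrix (Fin 1) (Fin 1) F}
  (hV : TV.IsSymm) (hW : TW.IsSymm) (hVd : IsUnit TV.det) (hWd : IsUnit TW.det)
  (hJV : JV = TV.map (algebraMap F E)) (hJW : J₁ = TW.map (algebraMap F E))
  [CompactSpace (adelic F E c 1 J₁ ⧸ (toAdelic F E c 1 J₁).range)]
  {s sref : adelicPair F E c N 1 JV J₁ →* adelicMpCont F (Fin n) (adelicGram F e TV TW)}
  (hs : (splittingDatum F E c N 1 e JV J₁ hcδ hδ hd hV hW hVd hWd hJV hJW).IsCompatible s)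
  (hsref : (splittingDatum F E c N 1 e JV J₁ hcδ hδ hd hV hW hVd hWd hJV hJW).IsCompatible sref)
  (hsc : Continuous s) (hsrefc : Continuous sref)
  (href : ∀ (b : finAdelic F E c 1 J₁) (f : FinSB F (Fin N × Fin 1)),
    finPairRep F E c N 1 e JV J₁ hcδ hδ hd hV hW hVd hWd hJV hJW hsref (1, b) f =
      (finSBReindex F e).symm (𝓢.Omega (finPairEmb F E c N 1 e JV J₁ (1, b)) (finSBReindex F e f)))

set_option maxHeartbeats 1600000 in
include hsc hsrefc href in
/-- **THE CARRIER BRIDGE.**  For two compatible continuous splittings `s`, `sref` of the dual pair `(U(J_V), U(J₁))` (`J₁` a hermitian line,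
`[U(J₁)]` compact), `sref` read on the finite pair as the place-assembled `Ω` of a restricted family `𝓢` (`href`), there is a CONTINUOUS
`w : U(J₁)(𝔸_{F,f}) → ℂ` with `‖w b‖ = 1` and `R_e (ω_f^{s}(1,b) (R_e⁻¹ Φ_f)) = w b • 𝓢.Omega (finPairEmb (1,b)) Φ_f` for all `b`, `Φ_f`
(`w b = ĉ(1 ⊗ (1,b))⁻¹` for the automorphic character `ĉ` with `sref = s ⊗ ĉ`).
[cite: GelbartRogawski1991, §3.1 Remark p. 457 L4–13] [cite: Weil1964, Chap. III n° 37–38 pp. 188–190] -/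
theorem exists_finPairRep_eq_smul_Omega :
    ∃ w : finAdelic F E c 1 J₁ → ℂ, Continuous w ∧ (∀ b, ‖w b‖ = 1) ∧
      ∀ (b : finAdelic F E c 1 J₁) (Φf : FinSB F (Fin n)),
        finSBReindex F e (finPairRep F E c N 1 e JV J₁ hcδ hδ hd hV hW hVd hWd hJV hJW hs (1, b) ((finSBReindex F e).symm Φf)) =
          w b • 𝓢.Omega (finPairEmb F E c N 1 e JV J₁ (1, b)) Φf := by
  classical
  -- the two splittings differ by an automorphic character `ĉ`
  obtain ⟨ĉ, hĉ, hĉrat, hĉc⟩ := exists_eq_twist_of_isCompatible F E c N 1 e JV J₁ hcδ hδ hd hV hW hVd hWd hJV hJW hs hsref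
  have hĉc' : Continuous ĉ := hĉc hsc hsrefc
  subst hĉ
  -- its `U(J₁)(𝔸_{F,f})`-part `tw` is a continuous unitary character
  set tw : finAdelic F E c 1 J₁ →* ℂˣ := twistCharW F E c N 1 JV J₁ ĉ with htw
  have htwc : Continuous fun b => ((tw b : ℂˣ) : ℂ) := by
    refine Units.continuous_val.comp ?_
    exact hĉc'.comp ((continuous_adelicInr F E c N 1 JV J₁).comp (continuous_finAdelicToAdelic F E c 1 J₁))
  have htwu : ∀ b, ‖((tw b : ℂˣ) : ℂ)‖ = 1 := fun b => by
    have h := norm_eq_one_of_forall_range_eq_one ((toAdelic F E c 1 J₁).range) (ĉ.comp (adelicInr F E c N 1 JV J₁))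
      (Units.continuous_val.comp (hĉc'.comp (continuous_adelicInr F E c N 1 JV J₁))) (by
        rintro _ ⟨γ, rfl⟩
        exact hĉrat _ (adelicInr_toAdelic_mem_range F E c N 1 JV J₁ γ)) (finAdelicToAdelic F E c 1 J₁ b)
    simpa [htw, twistCharW_apply] using h
  have hinv_eq : (fun b => (((tw b)⁻¹ : ℂˣ) : ℂ)) = fun b => conj ((tw b : ℂˣ) : ℂ) := by
    funext b
    rw [Units.val_inv_eq_inv_val]
    exact Complex.inv_eq_conj (htwu b)
  refine ⟨fun b => (((tw b)⁻¹ : ℂˣ) : ℂ), ?_, fun b => ?_, fun b Φf => ?_⟩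
  · rw [hinv_eq]
    exact Complex.continuous_conj.comp htwc
  · show ‖(((tw b)⁻¹ : ℂˣ) : ℂ)‖ = 1
    rw [Units.val_inv_eq_inv_val, norm_inv, htwu b, inv_one]
  · have htwist := finPairRep_twist F E c N 1 e JV J₁ hcδ hδ hd hV hW hVd hWd hJV hJW ĉ hs hsref (1, b) ((finSBReindex F e).symm Φf)
    rw [href, LinearEquiv.apply_symm_apply, map_one, one_mul] at htwist
    -- `htwist : R_e⁻¹ (Ω_b Φf) = tw b • ω_f^{s}(1,b) (R_e⁻¹ Φf)`
    have h2 : finPairRep F E c N 1 e JV J₁ hcδ hδ hd hV hW hVd hWd hJV hJW hs (1, b) ((finSBReindex F e).symm Φf) =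
        (((tw b)⁻¹ : ℂˣ) : ℂ) • (finSBReindex F e).symm (𝓢.Omega (finPairEmb F E c N 1 e JV J₁ (1, b)) Φf) := by
      rw [htwist, smul_smul, Units.val_inv_eq_inv_val, ← htw, inv_mul_cancel₀ (Units.ne_zero _), one_smul]
    rw [h2, LinearEquiv.map_smul, LinearEquiv.apply_symm_apply]

/-! ### The finite matrix coefficients of `ω_f^{s}` and of `Ω` are integrable together -/

variable [MeasurableSpace (FiniteAdeleRing (𝓞 F) F)] (μ : Measure (Fin n → FiniteAdeleRing (𝓞 F) F))
  [MeasurableSpace (finAdelic F E c 1 J₁)] [BorelSpace (finAdelic F E c 1 J₁)] (μb : Measure (finAdelic F E c 1 J₁))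

/-- pulling a scalar out of the coefficient: `⟨w • X, Ψ⟩_μ = w · ⟨X, Ψ⟩_μ`. [folklore] -/
private theorem integral_coe_smul_mul_conj (w : ℂ) (X Ψ : FinSB F (Fin n)) :
    ∫ y, (((w • X : FinSB F (Fin n)) : (Fin n → FiniteAdeleRing (𝓞 F) F) → ℂ) y) *
        conj (((Ψ : FinSB F (Fin n)) : (Fin n → FiniteAdeleRing (𝓞 F) F) → ℂ) y) ∂μ =
      w * ∫ y, ((X : FinSB F (Fin n)) : (Fin n → FiniteAdeleRing (𝓞 F) F) → ℂ) y *
        conj (((Ψ : FinSB F (Fin n)) : (Fin n → FiniteAdeleRing (𝓞 F) F) → ℂ) y) ∂μ := by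
  rw [← integral_const_mul]
  refine integral_congr_ae (Eventually.of_forall fun y => ?_)
  simp only [Submodule.coe_smul, Pi.smul_apply, smul_eq_mul, mul_assoc]

/-- a continuous unimodular weight does not change integrability. [folklore] -/
private theorem integrable_mul_of_unimodular {α : Type*} [TopologicalSpace α] [MeasurableSpace α] [OpensMeasurableSpace α]
    {ν : Measure α} {w : α → ℂ} (hwc : Continuous w) (hwu : ∀ b, ‖w b‖ = 1) {g : α → ℂ} (hg : Integrable g ν) :
    Integrable (fun b => w b * g b) ν :=
  hg.bdd_mul hwc.aestronglyMeasurable (Eventually.of_forall fun b => (hwu b).le)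

set_option maxHeartbeats 1600000 in
include hsref hsc hsrefc href in
/-- **`hF` TRANSFER, `Ω ⟹ ω_f^{s}`**: if the coefficients `b ↦ ⟨𝓢.Omega (finPairEmb (1,b)) Φ_f, Ψ_f⟩_μ` are integrable on `U(J₁)(𝔸_{F,f})`, so are
`b ↦ ⟨R_e ω_f^{s}(1,b) R_e⁻¹ Φ_f, Ψ_f⟩_μ` — the `hF` binder of ★ `orbitalSums_bounded_of_finIntegrable`, VERBATIM, for the consumer's `s`.
[cite: GelbartRogawski1991, §3.1 Remark p. 457 L4–13] [cite: Li1992, Thm 2.1 (27) p. 184; §5 p. 206] -/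
theorem integrable_finCoeff_of_integrable_Omega (Φf Ψf : FinSB F (Fin n))
    (h : Integrable (fun b : finAdelic F E c 1 J₁ =>
      ∫ y, ((𝓢.Omega (finPairEmb F E c N 1 e JV J₁ (1, b)) Φf : FinSB F (Fin n)) : (Fin n → FiniteAdeleRing (𝓞 F) F) → ℂ) y *
        conj ((Ψf : (Fin n → FiniteAdeleRing (𝓞 F) F) → ℂ) y) ∂μ) μb) :
    Integrable (fun b : finAdelic F E c 1 J₁ =>
      ∫ y, ((finSBReindex F e (finPairRep F E c N 1 e JV J₁ hcδ hδ hd hV hW hVd hWd hJV hJW hs (1, b)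
          ((finSBReindex F e).symm Φf)) : FinSB F (Fin n)) : (Fin n → FiniteAdeleRing (𝓞 F) F) → ℂ) y *
        conj ((Ψf : (Fin n → FiniteAdeleRing (𝓞 F) F) → ℂ) y) ∂μ) μb := by
  obtain ⟨w, hwc, hwu, hw⟩ := exists_finPairRep_eq_smul_Omega F E c N e JV J₁ hcδ hδ hd Tb hTb hJb 𝓢 hV hW hVd hWd hJV hJW hs hsref
    hsc hsrefc href
  have heq : (fun b : finAdelic F E c 1 J₁ =>
      ∫ y, ((finSBReindex F e (finPairRep F E c N 1 e JV J₁ hcδ hδ hd hV hW hVd hWd hJV hJW hs (1, b)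
          ((finSBReindex F e).symm Φf)) : FinSB F (Fin n)) : (Fin n → FiniteAdeleRing (𝓞 F) F) → ℂ) y *
        conj ((Ψf : (Fin n → FiniteAdeleRing (𝓞 F) F) → ℂ) y) ∂μ) =
      fun b => w b * ∫ y, ((𝓢.Omega (finPairEmb F E c N 1 e JV J₁ (1, b)) Φf : FinSB F (Fin n)) :
          (Fin n → FiniteAdeleRing (𝓞 F) F) → ℂ) y * conj ((Ψf : (Fin n → FiniteAdeleRing (𝓞 F) F) → ℂ) y) ∂μ := by
    funext b
    rw [hw b Φf, integral_coe_smul_mul_conj]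
  rw [heq]
  exact integrable_mul_of_unimodular hwc hwu h

set_option maxHeartbeats 1600000 in
include hsref hsc hsrefc href in
/-- **`hF` TRANSFER, `ω_f^{s} ⟹ Ω`** (the converse direction, `w⁻¹ = conj w` is again continuous unimodular).
[cite: GelbartRogawski1991, §3.1 Remark p. 457 L4–13] -/
theorem integrable_Omega_of_integrable_finCoeff (Φf Ψf : FinSB F (Fin n))
    (h : Integrable (fun b : finAdelic F E c 1 J₁ =>
      ∫ y, ((finSBReindex F e (finPairRep F E c N 1 e JV J₁ hcδ hδ hd hV hW hVd hWd hJV hJW hs (1, b)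
          ((finSBReindex F e).symm Φf)) : FinSB F (Fin n)) : (Fin n → FiniteAdeleRing (𝓞 F) F) → ℂ) y *
        conj ((Ψf : (Fin n → FiniteAdeleRing (𝓞 F) F) → ℂ) y) ∂μ) μb) :
    Integrable (fun b : finAdelic F E c 1 J₁ =>
      ∫ y, ((𝓢.Omega (finPairEmb F E c N 1 e JV J₁ (1, b)) Φf : FinSB F (Fin n)) : (Fin n → FiniteAdeleRing (𝓞 F) F) → ℂ) y *
        conj ((Ψf : (Fin n → FiniteAdeleRing (𝓞 F) F) → ℂ) y) ∂μ) μb := by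
  obtain ⟨w, hwc, hwu, hw⟩ := exists_finPairRep_eq_smul_Omega F E c N e JV J₁ hcδ hδ hd Tb hTb hJb 𝓢 hV hW hVd hWd hJV hJW hs hsref
    hsc hsrefc href
  have hw0 : ∀ b, w b ≠ 0 := fun b h0 => by simpa [h0] using hwu b
  have heq : (fun b : finAdelic F E c 1 J₁ =>
      ∫ y, ((𝓢.Omega (finPairEmb F E c N 1 e JV J₁ (1, b)) Φf : FinSB F (Fin n)) : (Fin n → FiniteAdeleRing (𝓞 F) F) → ℂ) y *
        conj ((Ψf : (Fin n → FiniteAdeleRing (𝓞 F) F) → ℂ) y) ∂μ) =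
      fun b => (w b)⁻¹ * ∫ y, ((finSBReindex F e (finPairRep F E c N 1 e JV J₁ hcδ hδ hd hV hW hVd hWd hJV hJW hs (1, b)
          ((finSBReindex F e).symm Φf)) : FinSB F (Fin n)) : (Fin n → FiniteAdeleRing (𝓞 F) F) → ℂ) y *
        conj ((Ψf : (Fin n → FiniteAdeleRing (𝓞 F) F) → ℂ) y) ∂μ := by
    funext b
    rw [hw b Φf, integral_coe_smul_mul_conj, ← mul_assoc, inv_mul_cancel₀ (hw0 b), one_mul]
  rw [heq]
  have hinv_eq : (fun b => (w b)⁻¹) = fun b => conj (w b) := funext fun b => Complex.inv_eq_conj (hwu b)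
  refine integrable_mul_of_unimodular ?_ (fun b => by rw [norm_inv, hwu b, inv_one]) h
  rw [hinv_eq]
  exact Complex.continuous_conj.comp hwc

end Generic

/-! ## §2 The CM line datum: reference family `𝓢_χ = congrW (undoubledSplittings (cmFinLocalFamily χ))` -/

section CMLine

variable (L : Type) [Field L] [NumberField L] [IsCMField L] {N n : ℕ} (e : Fin N × Fin 1 ≃ Fin n)
  (dV : Fin N → L) (hdV : ∀ i, IsCMField.complexConj L (dV i) = dV i) (hdV0 : ∀ i, dV i ≠ 0)
  (dW : Fin 1 → L) (hdW : ∀ i, IsCMField.complexConj L (dW i) = dW i) (hdW0 : ∀ i, dW i ≠ 0)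
  (χ : HeckeCharacter L) (hχu : χ.IsUnitary) (hχs : IsSplittingChar L 1 χ)
  {s : UnitaryGroup.adelicPair (Fp L) L (IsCMField.complexConj L) N 1 (Matrix.diagonal dV) (Matrix.diagonal dW) →*
    adelicMpCont (Fp L) (Fin n) (adelicGram (Fp L) e (realDiagonal L dV hdV) (realDiagonal L dW hdW))}
  (hs : (cmSplittingDatum L e dV hdV hdV0 dW hdW hdW0).IsCompatible s) (hsc : Continuous s)

set_option maxHeartbeats 2000000 in
include hdW0 hχu hsc in
/-- **the carrier bridge at the CM line datum**: for ANY compatible continuous splitting `s` of the CM dual pair `(U(diag dV), U(diag dW))`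
(`dW` a real non-zero line) and ANY unitary splitting character `χ` of `L`, there is a continuous unimodular `w` with
`R_e (ω_f^{s}(1,b) (R_e⁻¹ Φ_f)) = w b • 𝓢_χ.Omega (finPairEmb (1,b)) Φ_f`, `𝓢_χ = congrW (undoubledSplittings (cmFinLocalFamily χ))` the
`χ`-line family of ★ `finPairRep_chiSplittingLine_apply` (`[U(diag dW)]` compact by ★ `compactSpace_quotient_range_toAdelic_line`).
[cite: GelbartRogawski1991, §3.1 Prop. 3.1.1 p. 455, Remark p. 457 L4–13] [cite: Liu2021, App. D §D.1 Steps 1–3 (l. 5214–5233)] -/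
theorem exists_finPairRep_eq_smul_Omega_cm :
    ∃ w : UnitaryGroup.finAdelic (Fp L) L (IsCMField.complexConj L) 1 (Matrix.diagonal dW) → ℂ, Continuous w ∧ (∀ b, ‖w b‖ = 1) ∧
      ∀ (b : UnitaryGroup.finAdelic (Fp L) L (IsCMField.complexConj L) 1 (Matrix.diagonal dW)) (Φf : FinSB (Fp L) (Fin n)),
        finSBReindex (Fp L) e (finPairRep (Fp L) L (IsCMField.complexConj L) N 1 e (Matrix.diagonal dV) (Matrix.diagonal dW)
            (complexConj_imagUnit L) (imagUnit_ne_zero L) (imagUnit_mul_self L) (realDiagonal_isSymm L dV hdV)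
            (realDiagonal_isSymm L dW hdW) (isUnit_det_realDiagonal L dV hdV hdV0) (isUnit_det_realDiagonal L dW hdW hdW0)
            (realDiagonal_map L dV hdV).symm (realDiagonal_map L dW hdW).symm hs (1, b) ((finSBReindex (Fp L) e).symm Φf)) =
          w b • (congrW L e dV hdV (lineW L (realDiagonal L dW hdW)) (complexConj_lineW L (realDiagonal L dW hdW))
              (realDiagonal_lineW L (realDiagonal L dW hdW)) (diagonal_lineW L (realDiagonal L dW hdW) (realDiagonal_map L dW hdW).symm)
              (undoubledSplittings L e dV hdV hdV0 (lineW L (realDiagonal L dW hdW)) (complexConj_lineW L (realDiagonal L dW hdW))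
                (lineW_ne_zero L (realDiagonal L dW hdW) (isUnit_det_realDiagonal L dW hdW hdW0)) χ (borelPlaceMeasure L)
                (cmFinLocalFamily L e dV hdV hdV0 (lineW L (realDiagonal L dW hdW)) (complexConj_lineW L (realDiagonal L dW hdW))
                  (lineW_ne_zero L (realDiagonal L dW hdW) (isUnit_det_realDiagonal L dW hdW hdW0)) χ hχs (borelPlaceMeasure L)))
              (realDiagonal_isSymm L dW hdW) (realDiagonal_map L dW hdW).symm).Omega
            (finPairEmb (Fp L) L (IsCMField.complexConj L) N 1 e (Matrix.diagonal dV) (Matrix.diagonal dW) (1, b)) Φf := by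
  haveI := compactSpace_quotient_range_toAdelic_line L dW hdW hdW0
  exact exists_finPairRep_eq_smul_Omega (Fp L) L (IsCMField.complexConj L) N e (Matrix.diagonal dV) (Matrix.diagonal dW)
    (complexConj_imagUnit L) (imagUnit_ne_zero L) (imagUnit_mul_self L) _ _ _ _
    (realDiagonal_isSymm L dV hdV) (realDiagonal_isSymm L dW hdW) (isUnit_det_realDiagonal L dV hdV hdV0)
    (isUnit_det_realDiagonal L dW hdW hdW0) (realDiagonal_map L dV hdV).symm (realDiagonal_map L dW hdW).symm hs
    (isCompatible_chiSplittingLine L e dV hdV hdV0 χ hχu hχs (realDiagonal L dW hdW) (realDiagonal_isSymm L dW hdW)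
      (isUnit_det_realDiagonal L dW hdW hdW0) (Matrix.diagonal dW) (realDiagonal_map L dW hdW).symm)
    hsc
    (continuous_chiSplittingLine L e dV hdV hdV0 χ hχu hχs (realDiagonal L dW hdW) (isUnit_det_realDiagonal L dW hdW hdW0)
      (Matrix.diagonal dW) (realDiagonal_map L dW hdW).symm)
    (fun b f => finPairRep_chiSplittingLine_apply L e dV hdV hdV0 χ hχu hχs (realDiagonal L dW hdW) (realDiagonal_isSymm L dW hdW)
      (isUnit_det_realDiagonal L dW hdW hdW0) (Matrix.diagonal dW) (realDiagonal_map L dW hdW).symm (1, b) f)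

set_option maxHeartbeats 2000000 in
include hdW0 hχu hsc in
/-- **`hF` at the CM line datum from the `Ω_χ`-coefficients**: if `b ↦ ⟨𝓢_χ.Omega (finPairEmb (1,b)) Φ_f, Ψ_f⟩_μ` is integrable on
`U(diag dW)(𝔸_{L⁺,f})` then so is `b ↦ ⟨R_e ω_f^{s}(1,b) R_e⁻¹ Φ_f, Ψ_f⟩_μ` — the `hF` binder of ★ `orbitalSums_bounded_of_finIntegrable`
at `(L⁺, L, c̄, diag dV, diag dW, s)` for the given `μ`, `μ_b`, `Φ_f`, `Ψ_f`.
[cite: GelbartRogawski1991, §3.1 Remark p. 457 L4–13] [cite: Li1992, Thm 2.1 (27) p. 184; §5 p. 206] -/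
theorem integrable_finCoeff_cm_of_integrable_Omega
    [MeasurableSpace (FiniteAdeleRing (𝓞 (Fp L)) (Fp L))] (μ : Measure (Fin n → FiniteAdeleRing (𝓞 (Fp L)) (Fp L)))
    [MeasurableSpace (UnitaryGroup.finAdelic (Fp L) L (IsCMField.complexConj L) 1 (Matrix.diagonal dW))]
    [BorelSpace (UnitaryGroup.finAdelic (Fp L) L (IsCMField.complexConj L) 1 (Matrix.diagonal dW))]
    (μb : Measure (UnitaryGroup.finAdelic (Fp L) L (IsCMField.complexConj L) 1 (Matrix.diagonal dW)))
    (Φf Ψf : FinSB (Fp L) (Fin n))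
    (h : Integrable (fun b : UnitaryGroup.finAdelic (Fp L) L (IsCMField.complexConj L) 1 (Matrix.diagonal dW) =>
      ∫ y, (((congrW L e dV hdV (lineW L (realDiagonal L dW hdW)) (complexConj_lineW L (realDiagonal L dW hdW))
              (realDiagonal_lineW L (realDiagonal L dW hdW)) (diagonal_lineW L (realDiagonal L dW hdW) (realDiagonal_map L dW hdW).symm)
              (undoubledSplittings L e dV hdV hdV0 (lineW L (realDiagonal L dW hdW)) (complexConj_lineW L (realDiagonal L dW hdW))
                (lineW_ne_zero L (realDiagonal L dW hdW) (isUnit_det_realDiagonal L dW hdW hdW0)) χ (borelPlaceMeasure L)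
                (cmFinLocalFamily L e dV hdV hdV0 (lineW L (realDiagonal L dW hdW)) (complexConj_lineW L (realDiagonal L dW hdW))
                  (lineW_ne_zero L (realDiagonal L dW hdW) (isUnit_det_realDiagonal L dW hdW hdW0)) χ hχs (borelPlaceMeasure L)))
              (realDiagonal_isSymm L dW hdW) (realDiagonal_map L dW hdW).symm).Omega
            (finPairEmb (Fp L) L (IsCMField.complexConj L) N 1 e (Matrix.diagonal dV) (Matrix.diagonal dW) (1, b)) Φf :
            FinSB (Fp L) (Fin n)) : (Fin n → FiniteAdeleRing (𝓞 (Fp L)) (Fp L)) → ℂ) y *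
        conj ((Ψf : (Fin n → FiniteAdeleRing (𝓞 (Fp L)) (Fp L)) → ℂ) y) ∂μ) μb) :
    Integrable (fun b : UnitaryGroup.finAdelic (Fp L) L (IsCMField.complexConj L) 1 (Matrix.diagonal dW) =>
      ∫ y, ((finSBReindex (Fp L) e (finPairRep (Fp L) L (IsCMField.complexConj L) N 1 e (Matrix.diagonal dV) (Matrix.diagonal dW)
            (complexConj_imagUnit L) (imagUnit_ne_zero L) (imagUnit_mul_self L) (realDiagonal_isSymm L dV hdV)
            (realDiagonal_isSymm L dW hdW) (isUnit_det_realDiagonal L dV hdV hdV0) (isUnit_det_realDiagonal L dW hdW hdW0)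
            (realDiagonal_map L dV hdV).symm (realDiagonal_map L dW hdW).symm hs (1, b) ((finSBReindex (Fp L) e).symm Φf)) :
            FinSB (Fp L) (Fin n)) : (Fin n → FiniteAdeleRing (𝓞 (Fp L)) (Fp L)) → ℂ) y *
        conj ((Ψf : (Fin n → FiniteAdeleRing (𝓞 (Fp L)) (Fp L)) → ℂ) y) ∂μ) μb := by
  haveI := compactSpace_quotient_range_toAdelic_line L dW hdW hdW0
  exact integrable_finCoeff_of_integrable_Omega (Fp L) L (IsCMField.complexConj L) N e (Matrix.diagonal dV) (Matrix.diagonal dW)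
    (complexConj_imagUnit L) (imagUnit_ne_zero L) (imagUnit_mul_self L) _ _ _ _
    (realDiagonal_isSymm L dV hdV) (realDiagonal_isSymm L dW hdW) (isUnit_det_realDiagonal L dV hdV hdV0)
    (isUnit_det_realDiagonal L dW hdW hdW0) (realDiagonal_map L dV hdV).symm (realDiagonal_map L dW hdW).symm hs
    (isCompatible_chiSplittingLine L e dV hdV hdV0 χ hχu hχs (realDiagonal L dW hdW) (realDiagonal_isSymm L dW hdW)
      (isUnit_det_realDiagonal L dW hdW hdW0) (Matrix.diagonal dW) (realDiagonal_map L dW hdW).symm)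
    hsc
    (continuous_chiSplittingLine L e dV hdV hdV0 χ hχu hχs (realDiagonal L dW hdW) (isUnit_det_realDiagonal L dW hdW hdW0)
      (Matrix.diagonal dW) (realDiagonal_map L dW hdW).symm)
    (fun b f => finPairRep_chiSplittingLine_apply L e dV hdV hdV0 χ hχu hχs (realDiagonal L dW hdW) (realDiagonal_isSymm L dW hdW)
      (isUnit_det_realDiagonal L dW hdW hdW0) (Matrix.diagonal dW) (realDiagonal_map L dW hdW).symm (1, b) f)
    μ μb Φf Ψf h

end CMLine

end Summit.HodgeConjecture.HodgeConjecture.Cruxes.H413.ThetaNonvanishing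

end
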